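import Summits.AnomalousDissipation.AnomalousDissipation.Theorems.SolenoidalFractalHomogenisationLagrangianStepCellLawVSectorialOn
import Summits.AnomalousDissipation.AnomalousDissipation.Theorems.SolenoidalFractalHomogenisationLagrangianStepCellClauseCutsFamily
import Summits.AnomalousDissipation.AnomalousDissipation.Theorems.SolenoidalFractalHomogenisationLagrangianStepCellLawVQSPinch
import Summits.AnomalousDissipation.AnomalousDissipation.Theorems.SolenoidalFractalHomogenisationLagrangianStepCellLawVDesignPoint
import HarnessLib

/-!
# K1L_D (stmt-AnomalousDissipation-27980): the (W)-CROSSING line for `stub_cellLawV0_IS` — landed copy of the crux workfile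
`Cruxes/LagrangianRenormalisationStep/Lines/onelevel_W_crossing.lean` v2 (commit f677fdc0e2c7), §1–§5 WITHOUT the two named stubs
(`stub_W_evenSlackB`, `stub_D1_exactFamily`) and their two derived decls (`stub_W_closedFormB`, `stub_cellLawV0_IS_of_D1`), plus the
registry-v14 glue `cellLawV0_IS_of_W_D1` (tenure D26-4; prover ad-k1loc-p3 g7 on offer «TAKES-p3 #6»; `--supports 27980 --as helper`).

Declaration names and texts are UNCHANGED (token identity with planner ad-ideate-p5's certificate spine §W copies): §1 the residue currency
`RelSmall` and its perturbation lemmas; §2 `ResidueOnInterval`, `EvenSlackOnInterval`, `oddChannelOn_of_residue`; §3 `evenHalf_of_residue`;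
§4 `windowClause_of_WCrossing`, `windowFamily_of_WCrossing`, `RelSmall.smul`, `cellLawV0_IS_statement_of_WCrossing`; §5 `D1ExactFamily`,
`ClosedFormWindowB`, `cellLawV0_IS_statement_of_D1`, the branch-B data `MB`/`MB_pos`/`ρB`/`ρB_nonneg`/`ΦB`, `oddChannelOn_ΦB`, `EvenSlackWindowB`,
`closedFormWindowB_of_evenSlack`; NEW: `cellLawV0_IS_of_W_D1 : (∃ a > 0, EvenSlackWindowB a ρB) → (∀ a > 0, D1ExactFamily (ΦB a) ρB MB MB_pos) →
<registered stub_cellLawV0_IS text (registry v13 l.354–360) verbatim>`.  Nothing here proves the two obligations; K1L_D stays open; rung F-D1.A0.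
-/

set_option linter.dupNamespace false

namespace Summit.AnomalousDissipation.AnomalousDissipation.Theorems.SolenoidalFractalHomogenisation.LagrangianStep.WCrossing

open Summit.AnomalousDissipation.AnomalousDissipation.Theorems
open Summit.AnomalousDissipation.AnomalousDissipation.Theorems.SolenoidalFractalHomogenisation.LagrangianStep
open Literature.Analysis Literature.Analysis.FluidPDE Literature.Analysis.FunctionSpaces
open Set

noncomputable section

/-! ## §1 The residue currency and its two perturbation lemmas -/

/-- `R` is `ρ`-SMALL RELATIVE TO `A`: `bsymb R(k;p,q)² ≤ ρ² · symb A(k,p) · symb A(k,q)` for all transverse `p, q ⊥ k` (scale-free; covers the diagonal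
`symb R ≤ ρ·symb A` and the cross/odd entries in geometric-mean form). -/
def RelSmall (R A : T4) (ρ : ℝ) : Prop :=
  ∀ k p q : Fin 3 → ℝ, ∑ i, p i * k i = 0 → ∑ i, q i * k i = 0 →
    (Torus.bsymb R k p q) ^ 2 ≤ ρ ^ 2 * (Torus.symb A k p * Torus.symb A k q)

/-- Diagonal consequence: `|symb R(k,p)| ≤ ρ·symb A(k,p)`. [folklore] -/
theorem RelSmall.symb_abs_le {R A : T4} {ρ : ℝ} (h : RelSmall R A ρ) (hA : TransNonneg A) (hρ : 0 ≤ ρ)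
    (k p : Fin 3 → ℝ) (hkp : ∑ i, p i * k i = 0) : |Torus.symb R k p| ≤ ρ * Torus.symb A k p := by
  have h1 := h k p p hkp hkp
  rw [← Torus.symb_eq_bsymb] at h1
  have hnn : 0 ≤ ρ * Torus.symb A k p := mul_nonneg hρ (hA k p hkp)
  have h2 : (Torus.symb R k p) ^ 2 ≤ (ρ * Torus.symb A k p) ^ 2 := by nlinarith [h1]
  exact abs_le_of_sq_le_sq' h2 hnn |>.elim (fun h₁ h₂ => abs_le.mpr ⟨h₁, h₂⟩)

/-- Two-sided radial comparison `(1-ρ)·A ≼ A + R ≼ (1+ρ)·A`. [folklore] -/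
theorem RelSmall.transLE {R A : T4} {ρ : ℝ} (h : RelSmall R A ρ) (hA : TransNonneg A) (hρ : 0 ≤ ρ) :
    TransLE ((1 - ρ) • A) (A + R) ∧ TransLE (A + R) ((1 + ρ) • A) := by
  constructor
  · intro k p hkp
    have := abs_le.mp (h.symb_abs_le hA hρ k p hkp)
    rw [Torus.symb_smul, Torus.symb_add]; linarith [this.1]
  · intro k p hkp
    have := abs_le.mp (h.symb_abs_le hA hρ k p hkp)
    rw [Torus.symb_smul, Torus.symb_add]; linarith [this.2]

/-- Positivity of a tensor inside an order interval about a nonnegative centre. [folklore] -/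
theorem transNonneg_of_inInterval {Sstar A : T4} {lam : ℝ} (h : InInterval Sstar lam A) (hstar : TransNonneg Sstar) (hlam : 0 < lam) :
    TransNonneg A := by
  intro k p hkp
  have h1 := h.1 k p hkp
  rw [Torus.symb_smul] at h1
  exact le_trans (mul_nonneg (by positivity) (hstar k p hkp)) h1

/-- **EVEN perturbation lemma.**  `S⋆/λ' ≼ A ≼ λ' S⋆` and `R` `ρ`-small relative to `A` (`ρ < 1`) give `A + R` in the interval of aspect `λ'/(1-ρ)`
(uses `1 + ρ ≤ 1/(1-ρ)`). [folklore] -/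
theorem inInterval_add_of_relSmall {Sstar A R : T4} {lam ρ : ℝ} (h : InInterval Sstar lam A) (hR : RelSmall R A ρ)
    (hstar : TransNonneg Sstar) (hρ : 0 ≤ ρ) (hρ1 : ρ < 1) (hlam : 0 < lam) :
    InInterval Sstar (lam / (1 - ρ)) (A + R) := by
  have hA : TransNonneg A := transNonneg_of_inInterval h hstar hlam
  obtain ⟨hlo, hhi⟩ := hR.transLE hA hρ
  have h1ρ : 0 < 1 - ρ := by linarith
  constructor
  · intro k p hkp
    have ha := h.1 k p hkp
    have hb := hlo k p hkp
    rw [Torus.symb_smul] at ha hb ⊢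
    have hs := hstar k p hkp
    -- (1/(lam/(1-ρ))) s = ((1-ρ)/lam) s ≤ (1-ρ) symb A ≤ symb (A+R)
    have : 1 / (lam / (1 - ρ)) * Torus.symb Sstar k p = (1 - ρ) * (1 / lam * Torus.symb Sstar k p) := by
      field_simp
    rw [this]
    exact le_trans (mul_le_mul_of_nonneg_left ha h1ρ.le) hb
  · intro k p hkp
    have ha := h.2 k p hkp
    have hb := hhi k p hkp
    rw [Torus.symb_smul] at ha hb ⊢
    have hs := hstar k p hkp
    have hAp := hA k p hkp
    -- symb (A+R) ≤ (1+ρ) symb A ≤ (1+ρ) lam s ≤ lam/(1-ρ) s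
    have h3 : (1 + ρ) * (lam * Torus.symb Sstar k p) ≤ lam / (1 - ρ) * Torus.symb Sstar k p := by
      have h4 : (1 + ρ) ≤ 1 / (1 - ρ) := by
        rw [le_div_iff₀ h1ρ]; nlinarith
      have h5 : 0 ≤ lam * Torus.symb Sstar k p := mul_nonneg hlam.le hs
      calc (1 + ρ) * (lam * Torus.symb Sstar k p) ≤ (1 / (1 - ρ)) * (lam * Torus.symb Sstar k p) :=
            mul_le_mul_of_nonneg_right h4 h5
        _ = lam / (1 - ρ) * Torus.symb Sstar k p := by ring
    exact le_trans hb (le_trans (mul_le_mul_of_nonneg_left ha (by linarith)) h3)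

/-- **ODD perturbation lemma.**  `OddSectorial A τ` and `R` `ρ`-small relative to `A` (`ρ < 1`) give `OddSectorial (A + R) ((τ + 2ρ)/(1-ρ))`:
gain `1/(1-ρ)`, source `2ρ/(1-ρ)`. [folklore] -/
theorem oddSectorial_add_of_relSmall {A R : T4} {τ ρ : ℝ} (h : OddSectorial A τ) (hR : RelSmall R A ρ) (hA : TransNonneg A)
    (hτ : 0 ≤ τ) (hρ : 0 ≤ ρ) (hρ1 : ρ < 1) : OddSectorial (A + R) ((τ + 2 * ρ) / (1 - ρ)) := by
  intro k p q hp hq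
  have h1ρ : 0 < 1 - ρ := by linarith
  set a := Torus.symb A k p with ha_def
  set b := Torus.symb A k q with hb_def
  have ha : 0 ≤ a := hA k p hp
  have hb : 0 ≤ b := hA k q hq
  set s := Real.sqrt (a * b) with hs_def
  have hs : 0 ≤ s := Real.sqrt_nonneg _
  have hs2 : s ^ 2 = a * b := Real.sq_sqrt (mul_nonneg ha hb)
  -- the three small quantities
  have hx : |Torus.bsymb A k p q - Torus.bsymb A k q p| ≤ τ * s := by
    refine abs_le_of_sq_le_sq' ?_ (mul_nonneg hτ hs) |>.elim (fun h₁ h₂ => abs_le.mpr ⟨h₁, h₂⟩)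
    rw [mul_pow, hs2]; exact h k p q hp hq
  have hr1 : |Torus.bsymb R k p q| ≤ ρ * s := by
    refine abs_le_of_sq_le_sq' ?_ (mul_nonneg hρ hs) |>.elim (fun h₁ h₂ => abs_le.mpr ⟨h₁, h₂⟩)
    rw [mul_pow, hs2]; exact hR k p q hp hq
  have hr2 : |Torus.bsymb R k q p| ≤ ρ * s := by
    refine abs_le_of_sq_le_sq' ?_ (mul_nonneg hρ hs) |>.elim (fun h₁ h₂ => abs_le.mpr ⟨h₁, h₂⟩)
    rw [mul_pow, hs2, mul_comm a b]; exact hR k q p hq hp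
  -- odd part of A + R
  have hsum : Torus.bsymb (A + R) k p q - Torus.bsymb (A + R) k q p
      = (Torus.bsymb A k p q - Torus.bsymb A k q p) + Torus.bsymb R k p q - Torus.bsymb R k q p := by
    rw [Torus.bsymb_add, Torus.bsymb_add]; ring
  have hodd : |Torus.bsymb (A + R) k p q - Torus.bsymb (A + R) k q p| ≤ (τ + 2 * ρ) * s := by
    rw [hsum]
    calc |(Torus.bsymb A k p q - Torus.bsymb A k q p) + Torus.bsymb R k p q - Torus.bsymb R k q p|
        ≤ |(Torus.bsymb A k p q - Torus.bsymb A k q p) + Torus.bsymb R k p q| + |Torus.bsymb R k q p| := abs_sub _ _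
      _ ≤ |Torus.bsymb A k p q - Torus.bsymb A k q p| + |Torus.bsymb R k p q| + |Torus.bsymb R k q p| := by
          gcongr; exact abs_add_le _ _
      _ ≤ τ * s + ρ * s + ρ * s := by gcongr
      _ = (τ + 2 * ρ) * s := by ring
  -- even parts of A + R dominate (1-ρ)·a, (1-ρ)·b
  obtain ⟨hlo, _⟩ := hR.transLE hA hρ
  have hpa : (1 - ρ) * a ≤ Torus.symb (A + R) k p := by have := hlo k p hp; rwa [Torus.symb_smul] at this
  have hqb : (1 - ρ) * b ≤ Torus.symb (A + R) k q := by have := hlo k q hq; rwa [Torus.symb_smul] at this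
  have hc : 0 ≤ τ + 2 * ρ := by linarith
  -- square and compare
  have hsq : (Torus.bsymb (A + R) k p q - Torus.bsymb (A + R) k q p) ^ 2 ≤ ((τ + 2 * ρ) * s) ^ 2 := by
    have h0 : 0 ≤ (τ + 2 * ρ) * s := mul_nonneg hc hs
    exact sq_le_sq' (by linarith [(abs_le.mp hodd).1]) (abs_le.mp hodd).2
  have hab : a * b ≤ (Torus.symb (A + R) k p / (1 - ρ)) * (Torus.symb (A + R) k q / (1 - ρ)) := by
    have h1 : a ≤ Torus.symb (A + R) k p / (1 - ρ) := by rw [le_div_iff₀ h1ρ]; linarith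
    have h2 : b ≤ Torus.symb (A + R) k q / (1 - ρ) := by rw [le_div_iff₀ h1ρ]; linarith
    exact mul_le_mul h1 h2 hb (le_trans ha h1)
  calc (Torus.bsymb (A + R) k p q - Torus.bsymb (A + R) k q p) ^ 2
      ≤ ((τ + 2 * ρ) * s) ^ 2 := hsq
    _ = (τ + 2 * ρ) ^ 2 * (a * b) := by rw [mul_pow, hs2]
    _ ≤ (τ + 2 * ρ) ^ 2 * ((Torus.symb (A + R) k p / (1 - ρ)) * (Torus.symb (A + R) k q / (1 - ρ))) :=
        mul_le_mul_of_nonneg_left hab (sq_nonneg _)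
    _ = ((τ + 2 * ρ) / (1 - ρ)) ^ 2 * (Torus.symb (A + R) k p * Torus.symb (A + R) k q) := by
        field_simp

/-! ## §2 ODD crossing: the τ-local odd-channel bound passes from the design map `Φ₀` to `Φ = Φ₀ + residue` -/

/-- The RESIDUE HYPOTHESIS on the window, in the odd-channel shape (`λ ∈ [λ₀,Λ]`, `τ ∈ [0,τ₀]`): `Φ S − Φ₀ S` is `ρ`-small relative to `Φ₀ S`. -/
def ResidueOnInterval (Φ Φ₀ : T4 → T4) (Sstar : T4) (lam₀ Λ τ₀ ρ : ℝ) : Prop :=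
  ∀ lam ∈ Set.Icc lam₀ Λ, ∀ S : T4, ∀ τ ∈ Set.Icc 0 τ₀, InInterval Sstar lam S → OddSectorial S τ → RelSmall (Φ S - Φ₀ S) (Φ₀ S) ρ

/-- The EVEN HALF WITH SLACK `δ ≥ 0` for the design map, in the same shape: the image lands in the interval SHRUNK by `1+δ`. -/
def EvenSlackOnInterval (Φ₀ : T4 → T4) (Sstar : T4) (lam₀ Λ τ₀ δ : ℝ) : Prop :=
  ∀ lam ∈ Set.Icc lam₀ Λ, ∀ S : T4, ∀ τ ∈ Set.Icc 0 τ₀, InInterval Sstar lam S → OddSectorial S τ → InInterval Sstar (lam / (1 + δ)) (Φ₀ S)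

/-- **Odd crossing.**  [folklore] -/
theorem oddChannelOn_of_residue {Φ Φ₀ : T4 → T4} {Sstar : T4} {lam₀ Λ κ ε τ₀ ρ δ : ℝ}
    (hO : SectorialOddChannelBoundOn Φ₀ Sstar lam₀ Λ κ ε τ₀) (hE : EvenSlackOnInterval Φ₀ Sstar lam₀ Λ τ₀ δ)
    (hR : ResidueOnInterval Φ Φ₀ Sstar lam₀ Λ τ₀ ρ) (hstar : TransNonneg Sstar) (hlam₀ : 0 < lam₀) (hδ : 0 ≤ δ)
    (hκ : 0 ≤ κ) (hε : 0 ≤ ε) (hρ : 0 ≤ ρ) (hρ1 : ρ < 1) :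
    SectorialOddChannelBoundOn Φ Sstar lam₀ Λ (κ / (1 - ρ)) ((ε + 2 * ρ) / (1 - ρ)) τ₀ := by
  intro lam hlam S τ hτ hSi hSo
  have hlam' : 0 < lam / (1 + δ) := div_pos (hlam₀.trans_le hlam.1) (by linarith)
  have hnn : TransNonneg (Φ₀ S) := transNonneg_of_inInterval (hE lam hlam S τ hτ hSi hSo) hstar hlam'
  have h := oddSectorial_add_of_relSmall (hO lam hlam S τ hτ hSi hSo) (hR lam hlam S τ hτ hSi hSo) hnn
    (by nlinarith [hτ.1]) hρ hρ1
  have heq : Φ₀ S + (Φ S - Φ₀ S) = Φ S := by abel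
  rw [heq] at h
  convert h using 1; field_simp; ring

/-! ## §3 EVEN crossing with defect `μ = 1` -/

/-- **Even crossing.**  Slack `δ` for `Φ₀` and residue `ρ` with `1 ≤ (1-ρ)(1+δ)` give the even half for `Φ` at defect `μ = 1`, in the clause shape
(`τ ∈ [τlo, τhi] ⊆ [0, τ₀]`). [folklore] -/
theorem evenHalf_of_residue {Φ Φ₀ : T4 → T4} {Sstar : T4} {lam₀ Λ τ₀ τlo τhi ρ δ : ℝ}
    (hE : EvenSlackOnInterval Φ₀ Sstar lam₀ Λ τ₀ δ) (hR : ResidueOnInterval Φ Φ₀ Sstar lam₀ Λ τ₀ ρ) (hstar : TransNonneg Sstar)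
    (hlam₀ : 0 < lam₀) (hδ : 0 ≤ δ) (hρ : 0 ≤ ρ) (hfit : 1 ≤ (1 - ρ) * (1 + δ)) (hτlo : 0 ≤ τlo) (hτhi : τhi ≤ τ₀) :
    ∀ τ ∈ Set.Icc τlo τhi, ∀ lam ∈ Set.Icc lam₀ Λ, ∀ S : T4, OddSectorial S τ → InInterval Sstar lam S →
      InInterval Sstar (1 * lam) (Φ S) := by
  intro τ hτ lam hlam S hSo hSi
  have hτ' : τ ∈ Set.Icc 0 τ₀ := ⟨hτlo.trans hτ.1, hτ.2.trans hτhi⟩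
  have hρ1 : ρ < 1 := by nlinarith
  have hlam0 : 0 < lam := hlam₀.trans_le hlam.1
  have hlam' : 0 < lam / (1 + δ) := div_pos hlam0 (by linarith)
  have h := inInterval_add_of_relSmall (hE lam hlam S τ hτ' hSi hSo) (hR lam hlam S τ hτ' hSi hSo) hstar hρ hρ1 hlam'
  have heq : Φ₀ S + (Φ S - Φ₀ S) = Φ S := by abel
  rw [heq] at h
  refine h.mono hstar (div_pos hlam' (by linarith)) ?_
  -- lam/(1+δ)/(1-ρ) ≤ 1·lam  ⟸  1 ≤ (1-ρ)(1+δ)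
  rw [div_div, one_mul, div_le_iff₀ (by nlinarith)]
  nlinarith

end

end Summit.AnomalousDissipation.AnomalousDissipation.Theorems.SolenoidalFractalHomogenisation.LagrangianStep.WCrossing
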